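import Summits.BirchSwinnertonDyer.Rank1Residual.X1.StableCyclicQuotient
import Literature.NumberTheory.EllipticCurves.SupersingularIrreducibleProofs
import Literature.NumberTheory.EllipticCurves.ReducibleTorsionRibetLattice
import HarnessLib

/-!
# The good lattice EXISTS in every isogeny class: kernel discharge of the cited fact
# `ribet_exists_isIsogenous_noUnramifiedLine`

Cell `bsd-eis` (FULL-BSD rank-≤1 programme, row A1; home `run/shared/lean/pub/bsd-eis/`), seat
`bsd-eis-ky` (prover, Keller–Yin verification) gen 3, memo `HOME/bsd-eis-ky-MEMO-3.md` §5 R2.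

`Literature/NumberTheory/EllipticCurves/ReducibleTorsionRibetLattice.lean` vendors, as a NAMED FACT,
Ribet's lemma for `E/ℚ` at a good Eisenstein prime `p > 2` (Ribet 1976 Prop. 2.1 + Faltings + *AEC*
III.4.12): the isogeny class of a globally minimal elliptic `W/ℚ` with `Good W p`, `Red W p` contains a
globally minimal `W'` NONE of whose rational `p`-lines is unramified at `p` — Keller–Yin's "good
lattice" (arXiv:2402.12781v2 Prop. 1.3.1), the member on which the cell's THEOREM A
(`X1/KellerYinTheoremA.lean`) is proved. THIS FILE PROVES IT IN THE KERNEL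
(`ribet_exists_isIsogenous_noUnramifiedLine_holds`), by the elementary isogeny-graph argument instead
of Ribet's lattice argument:

* if `W` has no unramified rational `p`-line, take `W' = W`;
* otherwise let `Φ` be an unramified rational line and consider the `Γ_ℚ`-stable CYCLIC subgroups
  `ℤx ⊂ E(ℚ̄)` of order `p^k` with `(ℤx)[p] = Φ`; `k = 1` occurs (`Φ` itself) and the possible `k` are
  bounded (`X1.StableCyclicQuotient.bddAbove_setOf_stableCyclic`: Shafarevich finiteness of the isogeny
  class, tree `finite_isogenyClass_holds`, and `degree_eq_of_isCyclic`); take `k` MAXIMAL and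
  `W' =` a globally minimal model of `E/ℤx` (`exists_minimal_isogeny_ker_eq`);
* if `W'` had an unramified rational line `Ψ = ℤ q₀`, pick `y ∈ E(ℚ̄)` over `q₀`; then `p y = a x`.
  If `p ∤ a`, `ℤy ⊃ ℤx` is `Γ_ℚ`-stable cyclic of order `p^{k+1}` with `(ℤy)[p] = Φ` — contradicting
  maximality. If `p ∣ a`, `z = y - (a/p) x ∈ E[p]` maps to `q₀`, so `Ψ` is the image of `E[p]` under
  the restriction `E[p] → E'[p]` of the quotient map, whose kernel is `(ℤx)[p] = Φ`, unramified; by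
  `isRationalLine_range_and_not_unramified_of_ker` (the reduction line at the good ORDINARY `p`,
  `Rank1Residual.goodOrd_of_red_of_good`, is ramified and maps isomorphically onto the image) `Ψ` is
  NOT unramified — contradiction.

HONEST FRAMING. Unconditional kernel theorem; its only inputs are tree theorems (`_holds` discharges of
*AEC* III.4.12, VIII.8.3, IX.6.2, the reduction line at an ordinary prime, `End_ℚ(E) = ℤ`). It makes
`X1/KellerYinTheoremAClass.lean`'s hypothesis `hRibet` dischargeable by
`ribet_exists_isIsogenous_noUnramifiedLine_holds`.

## References
* [Ribet1976] K. A. Ribet, Invent. Math. 34 (1976) 151–162, Prop. 2.1 (the statement discharged).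
* [KellerYin2024] T. Keller, M. Yin, arXiv:2402.12781v2, Prop. 1.3.1 and §1.4 (the good lattice).
* [SilvermanAEC2009] J. H. Silverman, *AEC* 2nd ed., III.4.12, VIII.8.3, IX.6.2.
* HOME/bsd-eis-ky-MEMO-3.md §5 R2.
-/

set_option autoImplicit false

noncomputable section

open scoped Classical

open WeierstrassCurve NumberField IsDedekindDomain Literature.NumberTheory.EllipticCurves
  Literature.NumberTheory.EllipticCurves.Rank1Residual
  Literature.NumberTheory.GaloisRepresentations Field
  Summit.BirchSwinnertonDyer.Rank1Residual.X2.IsogenyLineType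
  Summit.BirchSwinnertonDyer.Rank1Residual.X2.IsogenyLineTypeGoodOrdinary
  Summit.BirchSwinnertonDyer.Rank1Residual.X1.StableCyclicQuotient

namespace Summit.BirchSwinnertonDyer.Rank1Residual.X1.GoodLatticeExists

variable {p : ℕ} [hp : Fact p.Prime]

/-! ## §5 The good lattice exists: the quotient by a MAXIMAL stable cyclic subgroup through the
unramified line has no unramified rational `p`-line -/

section Main

variable {V : WeierstrassCurve ℚ} [V.IsElliptic] [V.IsGloballyMinimal]

omit [V.IsElliptic] [V.IsGloballyMinimal] in
/-- `ℤ·x` is finite and `Γ_ℚ`-stable when `x` has finite order and `σx ∈ ℤx` for all `σ`. [folklore] -/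
private theorem zmultiples_finite_stable {x : V.geomPoints} {n : ℕ} (hn : n ≠ 0)
    (hord : addOrderOf x = n) (hstab : ∀ σ : absoluteGaloisGroup ℚ, σ • x ∈ AddSubgroup.zmultiples x) :
    (AddSubgroup.zmultiples x : Set V.geomPoints).Finite ∧
      ∀ (σ : absoluteGaloisGroup ℚ) (P : V.geomPoints), P ∈ AddSubgroup.zmultiples x →
        σ • P ∈ AddSubgroup.zmultiples x := by
  refine ⟨?_, fun σ P hP ↦ ?_⟩
  · have : Finite (AddSubgroup.zmultiples x) := by
      apply Nat.finite_of_card_ne_zero; rw [Nat.card_zmultiples, hord]; exact hn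
    exact Set.toFinite _
  · obtain ⟨m, rfl⟩ := AddSubgroup.mem_zmultiples_iff.mp hP
    rw [smul_comm σ m x]
    exact AddSubgroup.zsmul_mem _ (hstab σ) m

/-- **The good lattice exists in every isogeny class** (kernel form of Keller–Yin's Prop. 1.3.1 /
Ribet's lemma for `E/ℚ` at a good ordinary odd `p` with `E[p]` reducible). If `E` has an unramified
rational `p`-line `Φ`, take a `Γ_ℚ`-stable cyclic subgroup `ℤx ⊂ E(ℚ̄)` with `(ℤx)[p] = Φ` of MAXIMAL
order `p^k` (`bddAbove_setOf_stableCyclic`) and `E' = E/ℤx` (globally minimal model); if `E'` had an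
unramified rational line `Ψ`, its preimage `C' ⊃ ℤx` of order `p^{k+1}` is either cyclic and stable —
contradicting maximality — or contains `E[p]`, whence `Ψ` is the image of `E[p]`, which is RAMIFIED
(`isRationalLine_range_and_not_unramified_of_ker`, the reduction line at the ordinary `p`) —
contradiction. If `E` has no unramified rational line, `E' = E`.
[cite: KellerYin2024, Prop. 1.3.1 and §1.4 (arXiv:2402.12781v2)] [cite: SilvermanAEC2009, Prop. III.4.12, Cor. IX.6.2] -/
theorem exists_isIsogenous_noUnramifiedLine (hp2 : 2 < p) (hgood : Good V p) (hred : Red V p) :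
    ∃ (W : WeierstrassCurve ℚ) (_ : W.IsElliptic) (_ : W.IsGloballyMinimal),
      IsIsogenous V W ∧
        ∀ Φ : AddSubgroup (geomTorsion W (p : ℤ)), IsRationalLine W p Φ → ¬ LineUnramifiedAt W p Φ := by
  have hp' : p.Prime := hp.out
  have hpz : Prime (p : ℤ) := Int.prime_iff_natAbs_prime.mpr (by simpa using hp')
  by_cases hex : ∃ Φ : AddSubgroup (geomTorsion V (p : ℤ)), IsRationalLine V p Φ ∧ LineUnramifiedAt V p Φ
  swap
  · push Not at hex
    exact ⟨V, inferInstance, inferInstance, IsIsogenous.refl_holds V, hex⟩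
  obtain ⟨Φ, hΦ, hu⟩ := hex
  have hord : GoodOrd V p := Rank1Residual.goodOrd_of_red_of_good V p hp2 hgood hred
  -- the line `Φ' = Φ ⊂ E(ℚ̄)` and a generator
  set Φ' : AddSubgroup V.geomPoints := Φ.map (geomTorsion V (p : ℤ)).subtype with hΦ'
  have hΦ'card : Nat.card Φ' = p := X2.IsogenyQuotientLine.natCard_map_subtype hΦ
  obtain ⟨x₀, hx₀Φ, hx₀0, hx₀ord, hx₀gen⟩ := exists_generator_of_prime_card (p := p) Φ' hΦ'card
  -- the set of good orders is non-empty (k = 1) and bounded; take the maximum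
  let T : Set ℕ := {k : ℕ | ∃ x : V.geomPoints, addOrderOf x = p ^ k ∧
    (∀ σ : absoluteGaloisGroup ℚ, σ • x ∈ AddSubgroup.zmultiples x) ∧
      p ^ (k - 1) • x ∈ Φ' ∧ p ^ (k - 1) • x ≠ 0}
  have h1T : 1 ∈ T := by
    refine ⟨x₀, by rw [pow_one]; exact hx₀ord, fun σ ↦ ?_,
      by rw [Nat.sub_self, pow_zero, one_smul]; exact hx₀Φ, by rw [Nat.sub_self, pow_zero, one_smul]; exact hx₀0⟩
    rw [hx₀gen]
    obtain ⟨P, hP, rfl⟩ := hx₀Φ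
    exact ⟨σ • P, hΦ.2 σ P hP, rfl⟩
  have hbdd : BddAbove T := by
    refine BddAbove.mono (fun k hk ↦ ?_) (bddAbove_setOf_stableCyclic (V := V) (p := p))
    obtain ⟨x, h1, h2, -⟩ := hk
    exact ⟨x, h1, h2⟩
  obtain ⟨x, hxord, hxstab, hxΦ, hx0⟩ : sSup T ∈ T := Nat.sSup_mem ⟨1, h1T⟩ hbdd
  set k := sSup T with hk
  have hk1 : 1 ≤ k := le_csSup hbdd h1T
  -- `t = p^{k-1} x` generates `Φ'`, of order `p`
  set t : V.geomPoints := p ^ (k - 1) • x with ht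
  have htgen : AddSubgroup.zmultiples t = Φ' := by
    obtain ⟨t₁, -, -, ht₁ord, ht₁gen⟩ := exists_generator_of_prime_card (p := p) Φ' hΦ'card
    have := eq_of_prime_card_of_mem (p := p) (H₁ := AddSubgroup.zmultiples t) (H₂ := Φ') ?_ hΦ'card hx0
      (AddSubgroup.mem_zmultiples t) hxΦ
    · exact this
    · -- `ord t = p`: `t ∈ Φ'` non-zero
      rw [Nat.card_zmultiples]
      haveI : Finite Φ' := Nat.finite_of_card_ne_zero (by rw [hΦ'card]; exact hp'.ne_zero)
      have hdvd : addOrderOf (⟨t, hxΦ⟩ : Φ') ∣ p := by rw [← hΦ'card]; exact addOrderOf_dvd_natCard _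
      rw [AddSubgroup.addOrderOf_mk] at hdvd
      rcases (Nat.dvd_prime hp').mp hdvd with h | h
      · exact absurd (AddMonoid.addOrderOf_eq_one_iff.mp h) hx0
      · exact h
  have htord : addOrderOf t = p := by
    have h := congrArg (fun H : AddSubgroup V.geomPoints ↦ Nat.card H) htgen
    simp only [Nat.card_zmultiples] at h
    rw [h, hΦ'card]
  -- the quotient `E' = E/ℤx`
  obtain ⟨hfin, hst⟩ := zmultiples_finite_stable (V := V) (pow_ne_zero k hp'.ne_zero) hxord hxstab
  obtain ⟨W, hW, hWmin, g, hker⟩ := exists_minimal_isogeny_ker_eq (AddSubgroup.zmultiples x) hfin hst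
  refine ⟨W, hW, hWmin, ⟨g⟩, fun Ψ hΨ hunΨ ↦ ?_⟩
  -- a generator `q₀` of `Ψ` and a preimage `y`
  obtain ⟨q₀, hq₀Ψ, hq₀0, -, hq₀gen⟩ := exists_generator_of_prime_card (p := p) Ψ hΨ.1
  obtain ⟨y, hy⟩ := g.surjective (q₀ : W.geomPoints)
  -- `p y ∈ ker g = ℤ x`: `a x = p y`
  have hpy : (p : ℤ) • y ∈ g.toAddMonoidHom.ker := by
    rw [AddMonoidHom.mem_ker, map_zsmul, Isogeny.coe_toAddMonoidHom, hy]
    have h0 : (p : ℤ) • (q₀ : W.geomPoints) = 0 := (Submodule.mem_torsionBy_iff (p : ℤ) _).mp q₀.2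
    exact h0
  rw [hker] at hpy
  obtain ⟨a, ha⟩ := AddSubgroup.mem_zmultiples_iff.mp hpy
  -- `p^k x = 0`
  have hpkx : ((p : ℤ) ^ k) • x = 0 := by
    rw [← Nat.cast_pow, natCast_zsmul, ← hxord]; exact addOrderOf_nsmul_eq_zero x
  by_cases hdvd : (p : ℤ) ∣ a
  · ---------------------------------------------------------------- `p ∣ a`: then `E[p] ↠ Ψ` — ramified
    obtain ⟨a', rfl⟩ := hdvd
    set z : V.geomPoints := y - a' • x with hz
    have hpz0 : (p : ℤ) • z = 0 := by
      rw [hz, smul_sub, ← ha, smul_smul]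
      exact sub_self _
    have hzmem : z ∈ geomTorsion V (p : ℤ) := (Submodule.mem_torsionBy_iff (p : ℤ) _).mpr hpz0
    have hxker : x ∈ g.toAddMonoidHom.ker := by rw [hker]; exact AddSubgroup.mem_zmultiples x
    have hgz : g z = (q₀ : W.geomPoints) := by
      rw [hz, map_sub, map_zsmul, hy]
      rw [AddMonoidHom.mem_ker, Isogeny.coe_toAddMonoidHom] at hxker
      rw [hxker, smul_zero, sub_zero]
    -- restrict `g` to `E[p]`; its kernel is `(ℤx)[p] = Φ`
    obtain ⟨g', hg'val, hg'⟩ := X2.IsogenyLineType.exists_restrict_torsion (p := p) g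
    have hker' : g'.ker = Φ := by
      ext P
      rw [AddMonoidHom.mem_ker]
      constructor
      · intro hP
        have h1 : (P : V.geomPoints) ∈ g.toAddMonoidHom.ker := by
          rw [AddMonoidHom.mem_ker, Isogeny.coe_toAddMonoidHom, ← hg'val, hP]; rfl
        rw [hker] at h1
        obtain ⟨m, hm⟩ := AddSubgroup.mem_zmultiples_iff.mp h1
        -- `p^k ∣ p m` since `p (m x) = 0`
        have hP0 : (p : ℤ) • (P : V.geomPoints) = 0 := (Submodule.mem_torsionBy_iff (p : ℤ) _).mp P.2
        have hdiv : (addOrderOf x : ℤ) ∣ p * m := by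
          rw [addOrderOf_dvd_iff_zsmul_eq_zero, mul_smul, hm, hP0]
        rw [hxord, Nat.cast_pow] at hdiv
        obtain ⟨m', hm'⟩ : (p : ℤ) ^ (k - 1) ∣ m := by
          have hk' : k = (k - 1) + 1 := by omega
          have hdiv' : (p : ℤ) ^ (k - 1) * p ∣ m * p := by
            rw [hk', pow_succ, mul_comm (p : ℤ) m] at hdiv; exact hdiv
          have hp0 : (p : ℤ) ≠ 0 := by exact_mod_cast hp'.ne_zero
          exact (mul_dvd_mul_iff_right hp0).mp hdiv'
        -- so `P = m' • t ∈ Φ'`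
        have hPt : (P : V.geomPoints) ∈ Φ' := by
          rw [← htgen, AddSubgroup.mem_zmultiples_iff]
          refine ⟨m', ?_⟩
          rw [ht, ← hm, hm', mul_comm, mul_smul, ← Nat.cast_pow, natCast_zsmul]
        obtain ⟨Q, hQ, hQP⟩ := hPt
        have : Q = P := Subtype.ext hQP
        exact this ▸ hQ
      · intro hP
        have hPt : (P : V.geomPoints) ∈ Φ' := ⟨P, hP, rfl⟩
        rw [← htgen, AddSubgroup.mem_zmultiples_iff] at hPt
        obtain ⟨m, hm⟩ := hPt
        have h1 : (P : V.geomPoints) ∈ g.toAddMonoidHom.ker := by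
          rw [hker, AddSubgroup.mem_zmultiples_iff]
          exact ⟨m * (p : ℤ) ^ (k - 1), by rw [mul_smul, ← hm, ht, ← Nat.cast_pow, natCast_zsmul]⟩
        rw [AddMonoidHom.mem_ker, Isogeny.coe_toAddMonoidHom, ← hg'val] at h1
        exact Subtype.ext h1
    have hK : Nat.card g'.ker = p := by rw [hker']; exact hΦ.1
    obtain ⟨hrat, hnram⟩ := isRationalLine_range_and_not_unramified_of_ker g' hg'
      (Rank1Residual.natCard_geomTorsion V p)
      (X2.IsogenyLineTypeGoodOrdinary.exists_reductionLine_adicCompletionPrime V p (by omega) hgood hord.2)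
      hK (hker' ▸ hu)
    -- `g'(E[p]) = Ψ`: both are lines containing `q₀ ≠ 0`
    have hq₀range : q₀ ∈ g'.range := by
      refine ⟨⟨z, hzmem⟩, Subtype.ext ?_⟩
      rw [hg'val]; exact hgz
    have hrange : g'.range = Ψ := eq_of_prime_card_of_mem (p := p) hrat.1 hΨ.1 hq₀0 hq₀range hq₀Ψ
    exact hnram (hrange ▸ hunΨ)
  · ---------------------------------------------------------------- `p ∤ a`: `ℤy` is a bigger good subgroup
    -- `x ∈ ℤ y` (Bezout: `a` is a unit mod `p^k`)
    have hcop : IsCoprime ((p : ℤ) ^ k) a := (IsCoprime.pow_left ((Prime.coprime_iff_not_dvd hpz).mpr hdvd))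
    obtain ⟨u, v, huv⟩ := hcop
    have hxy : x ∈ AddSubgroup.zmultiples y := by
      have : x = v • ((p : ℤ) • y) := by
        calc x = (u * (p : ℤ) ^ k + v * a) • x := by rw [huv, one_smul]
          _ = u • (((p : ℤ) ^ k) • x) + v • (a • x) := by rw [add_smul, mul_smul, mul_smul]
          _ = v • ((p : ℤ) • y) := by rw [hpkx, smul_zero, zero_add, ha]
      rw [this, smul_smul]
      exact AddSubgroup.zsmul_mem _ (AddSubgroup.mem_zmultiples y) _
    -- `p^k y = a t ≠ 0` lies in `Φ'`, and `p^{k+1} y = 0`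
    have hpky : p ^ k • y = a • t := by
      have hk' : k = (k - 1) + 1 := by omega
      calc p ^ k • y = ((p : ℤ) ^ (k - 1) * (p : ℤ)) • y := by
              rw [← natCast_zsmul, Nat.cast_pow, ← pow_succ, ← hk']
        _ = ((p : ℤ) ^ (k - 1) * a) • x := by rw [mul_smul ((p : ℤ) ^ (k - 1)) (p : ℤ) y, ← ha, ← mul_smul]
        _ = a • t := by rw [mul_comm, mul_smul, ht, ← natCast_zsmul x (p ^ (k - 1)), Nat.cast_pow]
    have hat0 : a • t ≠ 0 := by
      intro h0
      apply hdvd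
      have := addOrderOf_dvd_iff_zsmul_eq_zero.mpr h0
      rwa [htord] at this
    have hpk1y : p ^ (k + 1) • y = 0 := by
      calc p ^ (k + 1) • y = p • (p ^ k • y) := by rw [pow_succ', mul_smul]
        _ = p • (a • t) := by rw [hpky]
        _ = a • (p • t) := smul_comm _ _ _
        _ = 0 := by rw [← htord, addOrderOf_nsmul_eq_zero, smul_zero]
    have hyord : addOrderOf y = p ^ (k + 1) :=
      addOrderOf_eq_prime_pow (by rw [hpky]; exact hat0) hpk1y
    -- `ℤ y` is `Γ_ℚ`-stable: `g(σ y) = σ q₀ = m q₀ = g(m y)`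
    have hystab : ∀ σ : absoluteGaloisGroup ℚ, σ • y ∈ AddSubgroup.zmultiples y := by
      intro σ
      have hσq : σ • q₀ ∈ AddSubgroup.zmultiples q₀ := by rw [hq₀gen]; exact hΨ.2 σ q₀ hq₀Ψ
      obtain ⟨m, hm⟩ := AddSubgroup.mem_zmultiples_iff.mp hσq
      have hdiff : σ • y - m • y ∈ g.toAddMonoidHom.ker := by
        rw [AddMonoidHom.mem_ker, map_sub, map_zsmul, Isogeny.coe_toAddMonoidHom, Isogeny.map_smul, hy,
          ← AddSubgroup.torsionBy.coe_smul, ← hm]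
        simp
      rw [hker] at hdiff
      have hsub : AddSubgroup.zmultiples x ≤ AddSubgroup.zmultiples y := AddSubgroup.zmultiples_le_of_mem hxy
      have := hsub hdiff
      have h2 : σ • y = (σ • y - m • y) + m • y := by abel
      rw [h2]
      exact AddSubgroup.add_mem _ this (AddSubgroup.zsmul_mem _ (AddSubgroup.mem_zmultiples y) m)
    -- hence `k + 1` is a good order: contradiction with maximality
    have hmem : k + 1 ∈ T := by
      refine ⟨y, hyord, hystab, ?_, ?_⟩
      · rw [Nat.add_sub_cancel, hpky, ← htgen]
        exact AddSubgroup.zsmul_mem _ (AddSubgroup.mem_zmultiples t) a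
      · rw [Nat.add_sub_cancel, hpky]; exact hat0
    have : k + 1 ≤ k := hk ▸ le_csSup hbdd hmem
    omega

/-- **Discharge of the cited fact `ribet_exists_isIsogenous_noUnramifiedLine`** (Ribet's lemma for
elliptic curves over `ℚ` at a good Eisenstein prime `p > 2`, `Literature/…/ReducibleTorsionRibetLattice.lean`):
a THEOREM of the tree, by `exists_isIsogenous_noUnramifiedLine`.
[cite: Ribet1976, Prop. 2.1] [cite: KellerYin2024, Prop. 1.3.1 (arXiv:2402.12781v2)] -/
theorem ribet_exists_isIsogenous_noUnramifiedLine_holds : ribet_exists_isIsogenous_noUnramifiedLine :=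
  fun _ _ _ _ _ hp2 hgood hred ↦ exists_isIsogenous_noUnramifiedLine hp2 hgood hred

end Main

end Summit.BirchSwinnertonDyer.Rank1Residual.X1.GoodLatticeExists

end
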